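import Summits.AtomisticToContinuum.Crystallization.Theorems.ChargedEnergyGapChartDialW
import Literature.Geometry.DiscreteGeometry.KissingFanTriangleSets

/-!
# `ChargedEnergyGap` · the CHART DIAL, part ZA: THE FAN ANGLES OF A SCALE-FREE DOZEN
(decomp-a2c lens-3 g39 node «ChargeFreeGap»; eighth input of the [G] port plan — the analogue of the landed
`GappedShellCensusShellTrichotomyStubFanAngles.stub_fanAngles` for SCALE-FREE DOZENS, with the corner bounds of parts T/U/W)

**Dictionary, angle part.**  For a scale-free dozen `IsScaleFreeDozen t b` (part Q) let `u k = t k / ‖t k‖`, `X = {u k}`,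
pull the fan triangles `fanTriSets X` back to label triples `tri`, and put `ang S k = triAngleAt X (u '' S) (u k)`.
ASSUMING `0 ∈ interior (conv (range u))` (part X with part W's dictionary), we get:

* `ang ≥ 0`, `ang S k = 0` for `k ∉ S` (tree `triAngleAt_nonneg`, `triAngleAt_eq_zero_of_not_mem`);
* the node equation `Σ_{S ∈ tri} ang S k = 2π` (tree `sum_triAngleAt`);
* the corner bounds at `t₀ = arccos (31/100)`: on a BONDED triangle `ang ≤ t₀` (`IsScaleFreeDozen.tCorner`, part W ⇐ part T
  `tCorner_le`); on `{v, a, x}` with bonds `va`, `ax` and `v ≠ x`: `ang {v,a,x} v ≤ t₀` (`IsScaleFreeDozen.hCorner` ⇐ part U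
  `halfCorner_le`); on `{v, d, a}` with `vd`, `va`, `dx`, `xa` bonds and `v ≠ x`: `ang {v,d,a} v ≤ 2 t₀`
  (`IsScaleFreeDozen.qCorner` ⇐ part U `qCorner_le`).  NO far-pair hypothesis anywhere (the scale-free class has none).

The fan angle `∠(perpTo (u v) (u a), perpTo (u v) (u b))` (`triAngleAt_eq_angle`) agrees with
`∠(perpTo (t v) (t a), perpTo (t v) (t b))` by scale invariance (`angle_perpTo_smul`); the private transport lemmas are
the tree's verbatim.  No `sorry`, no new axiom, no instance / notation / option; no new definitions.
-/

noncomputable section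

open scoped RealInnerProductSpace
open Literature.MathematicalPhysics.StatisticalMechanics
open Literature.Geometry.DiscreteGeometry
open Literature.Geometry.DiscreteGeometry.ShellCensus
open Summit.AtomisticToContinuum.Crystallization.Theses.PricedLinkCensus
open Summit.AtomisticToContinuum.Crystallization.Theorems.ChargedEnergyGapNegative
open InnerProductGeometry

namespace Summit.AtomisticToContinuum.Crystallization.Theorems.ChargedEnergyGapChartDial

/-! ### Scaling invariance of the dihedral angle -/

/-- `perpTo` is `0`-homogeneous in its first argument. -/
private theorem perpTo_smul_left (p q : E3) {c : ℝ} (hc : c ≠ 0) :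
    perpTo (c • p) q = perpTo p q := by
  rw [perpTo_def, perpTo_def, real_inner_smul_left, real_inner_smul_left, real_inner_smul_right,
    smul_smul]
  rcases eq_or_ne p 0 with rfl | hp
  · simp
  · have hpp : ⟪p, p⟫ ≠ 0 := fun h => hp (inner_self_eq_zero.1 h)
    congr 2
    field_simp

/-- The dihedral angle about the spoke `0p` between `q` and `r` is invariant under rescaling the
three points by nonzero resp. positive factors. -/
private theorem angle_perpTo_smul (p q r : E3) {α β γ : ℝ} (hα : α ≠ 0) (hβ : 0 < β) (hγ : 0 < γ) :
    angle (perpTo (α • p) (β • q)) (perpTo (α • p) (γ • r)) = angle (perpTo p q) (perpTo p r) := by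
  rw [perpTo_smul_left p _ hα, perpTo_smul_left p _ hα, perpTo_smul_right, perpTo_smul_right,
    angle_smul_left_of_pos _ _ hβ, angle_smul_right_of_pos _ _ hγ]

/-! ### Three-element label sets -/

/-- A three-element set `{v, a, b}` has `v ≠ a` and `v ≠ b`. -/
private theorem ne_of_card_triple {α : Type*} [DecidableEq α] {v a b : α}
    (h : ({v, a, b} : Finset α).card = 3) : v ≠ a ∧ v ≠ b := by
  constructor
  · rintro rfl
    rw [Finset.insert_idem] at h
    have := Finset.card_le_two (a := v) (b := b)
    omega
  · rintro rfl
    rw [Finset.insert_eq_of_mem (Finset.mem_insert_of_mem (Finset.mem_singleton_self v))] at h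
    have := Finset.card_le_two (a := a) (b := v)
    omega

/-- A three-element set containing `v` is `{v, a, b}` with `v, a, b` distinct. -/
private theorem exists_eq_triple {α : Type*} [DecidableEq α] {S : Finset α} (hS : S.card = 3)
    {v : α} (hv : v ∈ S) : ∃ a b, v ≠ a ∧ v ≠ b ∧ a ≠ b ∧ S = {v, a, b} := by
  obtain ⟨x, y, z, hxy, hxz, hyz, rfl⟩ := Finset.card_eq_three.1 hS
  simp only [Finset.mem_insert, Finset.mem_singleton] at hv
  rcases hv with rfl | rfl | rfl
  · exact ⟨y, z, hxy, hxz, hyz, rfl⟩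
  · exact ⟨x, z, hxy.symm, hyz, hxz, Finset.insert_comm _ _ _⟩
  · exact ⟨x, y, hxz.symm, hyz.symm, hxy, by rw [Finset.pair_comm y, Finset.insert_comm]⟩

/-! ### The labelled fan: triangles and angles pulled back along `u` -/

/-- The fan triangles of `X = u '' univ` are exactly the images of the label triples whose image
is a fan triangle. -/
private theorem fanTriSets_eq_image {u : Fin 12 → E3} (hX1 : ∀ y ∈ Finset.univ.image u, ‖y‖ = 1) :
    fanTriSets (Finset.univ.image u) =
      (Finset.univ.powerset.filter fun S : Finset (Fin 12) =>
        S.image u ∈ fanTriSets (Finset.univ.image u)).image fun S => S.image u := by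
  ext T
  simp only [Finset.mem_image, Finset.mem_filter, Finset.mem_powerset, Finset.subset_univ,
    true_and]
  constructor
  · intro hT
    have himg : (Finset.univ.filter fun k => u k ∈ T).image u = T := by
      ext y
      simp only [Finset.mem_image, Finset.mem_filter, Finset.mem_univ, true_and]
      constructor
      · rintro ⟨k, hk, rfl⟩
        exact hk
      · intro hy
        obtain ⟨k, -, rfl⟩ := Finset.mem_image.1 (subset_of_mem_fanTriSets hX1 hT hy)
        exact ⟨k, hy, rfl⟩
    exact ⟨_, by rw [himg]; exact hT, himg⟩
  · rintro ⟨S, hS, rfl⟩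
    exact hS

/-- **Node equation on the labelled fan**: the angles at the label `v` of the label triples sum
to `2π`. -/
private theorem sum_triAngleAt_labels {u : Fin 12 → E3} (hX1 : ∀ y ∈ Finset.univ.image u, ‖y‖ = 1)
    (huinj : Function.Injective u)
    (h0 : (0 : E3) ∈ interior (convexHull ℝ ((Finset.univ.image u : Finset E3) : Set E3)))
    (v : Fin 12) :
    ∑ S ∈ Finset.univ.powerset.filter (fun S : Finset (Fin 12) =>
        S.image u ∈ fanTriSets (Finset.univ.image u)),
      triAngleAt (Finset.univ.image u) (S.image u) (u v) = 2 * Real.pi := by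
  have hinj : Set.InjOn (fun S : Finset (Fin 12) => S.image u)
      ↑(Finset.univ.powerset.filter fun S : Finset (Fin 12) =>
        S.image u ∈ fanTriSets (Finset.univ.image u)) :=
    (Finset.image_injective huinj).injOn
  have h := sum_triAngleAt hX1 h0 (Finset.mem_image_of_mem u (Finset.mem_univ v))
  rwa [fanTriSets_eq_image hX1, Finset.sum_image hinj] at h

/-- **The angle of a labelled fan triangle `{v, a, b}` at `v` is the dihedral angle of the
ORIGINAL points** `∠(perpTo (t v) (t a), perpTo (t v) (t b))`. -/
private theorem triAngleAt_labels_eq {t u : Fin 12 → E3} (hu : ∀ k, u k = ‖t k‖⁻¹ • t k)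
    (hr : ∀ k, 0 < ‖t k‖) (hX1 : ∀ y ∈ Finset.univ.image u, ‖y‖ = 1)
    (huinj : Function.Injective u) {v a b : Fin 12}
    (hT : ({v, a, b} : Finset (Fin 12)).image u ∈ fanTriSets (Finset.univ.image u))
    (hva : v ≠ a) (hvb : v ≠ b) :
    triAngleAt (Finset.univ.image u) (({v, a, b} : Finset (Fin 12)).image u) (u v) =
      angle (perpTo (t v) (t a)) (perpTo (t v) (t b)) := by
  have himg : ({v, a, b} : Finset (Fin 12)).image u = {u v, u a, u b} := by
    rw [Finset.image_insert, Finset.image_insert, Finset.image_singleton]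
  rw [himg] at hT ⊢
  rw [triAngleAt_eq_angle hX1 hT (huinj.ne hva) (huinj.ne hvb), hu v, hu a, hu b]
  exact angle_perpTo_smul (t v) (t a) (t b) (inv_pos.2 (hr v)).ne' (inv_pos.2 (hr a))
    (inv_pos.2 (hr b))

/-! ### The theorem -/

/-- **Dictionary, angle part, for a scale-free dozen** (node equation and corner bounds on the labelled fan; the
origin-interior hypothesis `h0` is discharged by parts W + X). -/
theorem IsScaleFreeDozen.fanAngles {t : Fin 12 → E3} {b : Fin 12 → Fin 12 → Prop} (hD : IsScaleFreeDozen t b)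
    (h0 : (0 : E3) ∈ interior (convexHull ℝ (Set.range fun k => ‖t k‖⁻¹ • t k))) :
    let u : Fin 12 → E3 := fun k => ‖t k‖⁻¹ • t k
    let X : Finset E3 := Finset.univ.image u
    let tri : Finset (Finset (Fin 12)) := Finset.univ.powerset.filter fun S => S.image u ∈ fanTriSets X
    let ang : Finset (Fin 12) → Fin 12 → ℝ := fun S k => triAngleAt X (S.image u) (u k)
    (∀ S v, 0 ≤ ang S v) ∧ (∀ S v, v ∉ S → ang S v = 0) ∧ (∀ v, ∑ S ∈ tri, ang S v = 2 * Real.pi) ∧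
      (∀ S ∈ tri, (∀ v ∈ S, ∀ w ∈ S, v ≠ w → b v w) → ∀ v ∈ S, ang S v ≤ Real.arccos (31 / 100)) ∧
      (∀ v a x, ({v, a, x} : Finset (Fin 12)) ∈ tri → b v a → b a x → v ≠ x →
        ang {v, a, x} v ≤ Real.arccos (31 / 100)) ∧
      (∀ v d a x, ({v, d, a} : Finset (Fin 12)) ∈ tri → b v d → b v a → b d x → b x a → v ≠ x →
        ang {v, d, a} v ≤ 2 * Real.arccos (31 / 100)) := by
  intro u X tri ang
  have hu : ∀ k, u k = ‖t k‖⁻¹ • t k := fun k => rfl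
  have hr : ∀ k, 0 < ‖t k‖ := hD.norm_pos
  have hu1 : ∀ k, ‖u k‖ = 1 := hD.norm_normalize
  have hX1 : ∀ y ∈ X, ‖y‖ = 1 := by
    intro y hy
    obtain ⟨k, -, rfl⟩ := Finset.mem_image.1 hy
    exact hu1 k
  have huinj : Function.Injective u := hD.normalize_injective
  have h0' : (0 : E3) ∈ interior (convexHull ℝ (X : Set E3)) := by
    have hXu : (X : Set E3) = Set.range u := by
      rw [Finset.coe_image, Finset.coe_univ, Set.image_univ]
    rw [hXu]
    exact h0
  have hmem : ∀ {S : Finset (Fin 12)}, S ∈ tri → S.image u ∈ fanTriSets X := fun hS =>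
    (Finset.mem_filter.1 hS).2
  have hcard : ∀ {S : Finset (Fin 12)}, S ∈ tri → S.card = 3 := fun hS => by
    rw [← Finset.card_image_of_injective _ huinj]
    exact card_eq_three_of_mem_fanTriSets hX1 (hmem hS)
  refine ⟨fun S v => triAngleAt_nonneg _ _ _,
    fun S v hv => triAngleAt_eq_zero_of_not_mem (mt huinj.mem_finset_image.1 hv),
    fun v => sum_triAngleAt_labels hX1 huinj h0' v, ?_, ?_, ?_⟩
  · -- T-corner: a bonded triangle
    intro S hS hb v hv
    have hT := hmem hS
    obtain ⟨a, c, hva, hvc, hac, rfl⟩ := exists_eq_triple (hcard hS) hv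
    have ha : a ∈ ({v, a, c} : Finset (Fin 12)) := by simp
    have hc : c ∈ ({v, a, c} : Finset (Fin 12)) := by simp
    refine (triAngleAt_labels_eq hu hr hX1 huinj hT hva hvc).trans_le ?_
    exact hD.tCorner (hb v hv a ha hva) (hb v hv c hc hvc) (hb a ha c hc hac)
  · -- half-quad corner: `{v, a, x}` with bonds `va`, `ax`
    intro v a x hS hva hax hvx
    have hT := hmem hS
    obtain ⟨hva', hvx'⟩ := ne_of_card_triple (hcard hS)
    refine (triAngleAt_labels_eq hu hr hX1 huinj hT hva' hvx').trans_le ?_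
    exact hD.hCorner hva hax hvx
  · -- quad corner: `{v, d, a}` with the quad `v d x a` bonded around
    intro v d a x hS hvd hva hdx hxa hvx
    have hT := hmem hS
    obtain ⟨hvd', hva'⟩ := ne_of_card_triple (hcard hS)
    refine (triAngleAt_labels_eq hu hr hX1 huinj hT hvd' hva').trans_le ?_
    exact hD.qCorner hvd hva hdx (hD.symm hxa) hvx

end Summit.AtomisticToContinuum.Crystallization.Theorems.ChargedEnergyGapChartDial

end
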